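import Literature.AnabelianGeometry.SemiGraphs.NodNonEdgeVerticialIncidenceProofs
import Literature.AnabelianGeometry.SemiGraphs.PSCTwoComponentAffineFreeFactors
import HarnessLib

/-!
# [NodNon] Lemma 1.7 at the genuine TWO-COMPONENT AFFINE data (one node, cusps on both components)

Hoshi–Mochizuki, *On the combinatorial anabelian geometry of nodally nondegenerate outer representations*,
Hiroshima Math. J. **41** (2011), Lemma 1.7 p. 290 [cite: HoshiMochizukiNodNon2011, Lem 1.7 p.290]
("`ẽ ∈ ℰ(ṽ)` ⟺ `Π_ṽ ∩ Π_ẽ ≠ {1}`; in particular then `Π_ẽ ⊆ Π_ṽ`"), typed over abc-iut-L3's `PSCDatum` as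
`PSCDatum.EdgeVerticialContainment` / `PSCDatum.EdgeVerticialAbutment` (`NodNonEdgeVerticialIncidence.lean`;
statements, never asserted).

PROOF-ONLY file (abc-iut-w5-d174 gen 6, row «LEM17@2C-AFFINE» keyed by abc-iut-L3-lead γ85 for the
[IUTchI] Cor. 2.3 (vi) consumers): the INSTANCE at every datum of abc-iut-f-164's TWO-COMPONENT AFFINE shape
(`PSCTwoComponentAffineShape.lean` / `…FreeFactors.lean`: a pointed stable curve `C₀ ∪_ν C₁`, handles
`i < g₀` and cusps `j ≥ s` on `C₀`, the others on `C₁`, `s ≥ 2`, `r − s ≥ 2`; `ι : Γ_{g,r} → Π` a profinite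
pro-`Σ` completion; `Π_{v₀}`, `Π_{v₁}`, `Π_ν = cl ι⟨ε⟩`) whose semi-graph records the incidences
(`nodeEnds ν = s(v₀, v₁)`, `Π_c ≤ Π_{cuspEnd c}`).  Mechanism: abc-iut-f-166's node-loop free basis `b'`
carries `Π_{v₀} = A_{S₀}`, `Π_{v₁} = A_{T₁}`, `Π_ν = A_{{σ}}` as sub-basis closures, so the vertex groups are
MALNORMAL (`mem_freeFactor_of_inf_conj_ne_bot`), the node group lies in both, and every cusp group lies in the
group of its component and meets every conjugate of the other trivially (abc-iut-f-164's three-bases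
computation, reproduced) — exactly the inputs of the criteria `edgeVerticialContainment_of_malnormal` /
`edgeVerticialAbutment_of_disjoint` of `NodNonEdgeVerticialIncidenceProofs.lean`.

* `edgeVerticialContainment_and_abutment_of_twoComponentAffine` — both typed clauses of [NodNon] Lem. 1.7 at
  every such datum.

A shape instance is consistency evidence for the typed predicate, not the printed lemma for all semi-graphs of
anabelioids of PSC-type (cell FOUNDATIONS rows 13–14).  0 definitions; nothing here takes a side on [IUTchIII]
Cor. 3.12.
-/

noncomputable section

namespace Literature.AnabelianGeometry.SemiGraphs

namespace PSCDatum

open scoped Pointwise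
open Literature.GroupTheory.CombinatorialGroupTheory
open Literature.GroupTheory.CombinatorialGroupTheory.PuncturedSurfaceGroup (a b c cuspInertia
  exists_freeGroupBasis_nodeLoop closure_firstSubsurface_eq_nodeLoopBasis
  closure_secondSubsurface_eq_nodeLoopBasis exists_freeGroupBasis_nodeLoop_cusp
  exists_freeGroupBasis_nodeLoop_cusp_zero)
open SemiGraphOfAnabelioids (IsProSigmaCompletion infinite_cuspInertia_closure)
open SemiGraphOfAnabelioids.IsProSigmaCompletion (freeFactor_inf_conj_eq_bot_of_disjoint infinite_freeFactor
  mem_freeFactor_of_inf_conj_ne_bot)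

universe u

variable {P : Type u} [Group P] [TopologicalSpace P] [IsTopologicalGroup P]
variable [CompactSpace P] [T2Space P] [TotallyDisconnectedSpace P] {Sigma : Set ℕ} {g r : ℕ}

omit [TopologicalSpace P] [IsTopologicalGroup P] [CompactSpace P] [T2Space P]
  [TotallyDisconnectedSpace P] in
/-- An infinite subgroup is not trivial. [cite: MochizukiCombGC2007, Rmk 1.1.3 p.7] -/
private theorem ne_bot_of_infinite₅ {H : Subgroup P} (h : Infinite H) : H ≠ ⊥ := by
  rintro rfl
  exact h.not_finite inferInstance

/-- **[NodNon] Lemma 1.7 (both typed clauses) at every genuine TWO-COMPONENT AFFINE datum whose semi-graph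
records the incidences.**  Hypotheses: abc-iut-f-164's two-component affine shape, `nodeEnds ν = s(v₀,v₁)`,
and every cusp group inside the group of its `cuspEnd`. [cite: HoshiMochizukiNodNon2011, Lem 1.7 p.290] -/
theorem edgeVerticialContainment_and_abutment_of_twoComponentAffine (hne : Sigma.Nonempty)
    (hprime : ∀ p ∈ Sigma, p.Prime) (ι : PuncturedSurfaceGroup g r →* P)
    (hι : IsProSigmaCompletion Sigma ι) (G : PSCDatum P) {g₀ s : ℕ} (hs : 2 ≤ s) (hsr : s + 2 ≤ r)
    (e : G.graph.C ≃ Fin r)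
    (hC : ∀ c', G.cuspGp c' =
      ((PuncturedSurfaceGroup.cuspInertia (g := g) (e c')).map ι).topologicalClosure)
    (v₀ v₁ : G.graph.V) (hV : ∀ w, w = v₀ ∨ w = v₁) (ε : PuncturedSurfaceGroup g r)
    (hε : ε = ((List.finRange r).map fun j : Fin r =>
          if s ≤ (j : ℕ) then PuncturedSurfaceGroup.c (g := g) j else 1).prod *
        ((List.finRange g).map fun i : Fin g => if (i : ℕ) < g₀ then
          PuncturedSurfaceGroup.a (r := r) i * PuncturedSurfaceGroup.b i *
            (PuncturedSurfaceGroup.a i)⁻¹ * (PuncturedSurfaceGroup.b i)⁻¹ else 1).prod)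
    (hV₀ : G.vertGp v₀ = ((Subgroup.closure {x : PuncturedSurfaceGroup g r |
        (∃ i : Fin g, (i : ℕ) < g₀ ∧ (x = PuncturedSurfaceGroup.a i ∨ x = PuncturedSurfaceGroup.b i)) ∨
        ∃ j : Fin r, s ≤ (j : ℕ) ∧ x = PuncturedSurfaceGroup.c j}).map ι).topologicalClosure)
    (hV₁ : G.vertGp v₁ = ((Subgroup.closure {x : PuncturedSurfaceGroup g r |
        (∃ i : Fin g, g₀ ≤ (i : ℕ) ∧ (x = PuncturedSurfaceGroup.a i ∨ x = PuncturedSurfaceGroup.b i)) ∨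
        (∃ j : Fin r, (j : ℕ) < s ∧ x = PuncturedSurfaceGroup.c j) ∨ x = ε}).map ι).topologicalClosure)
    (n₀ : G.graph.N) (hN : ∀ n, n = n₀)
    (hE : G.nodeGp n₀ = ((Subgroup.zpowers ε).map ι).topologicalClosure)
    (hends : G.graph.nodeEnds n₀ = s(v₀, v₁))
    (hcuspEnd : ∀ c', G.cuspGp c' ≤ G.vertGp (G.graph.cuspEnd c')) :
    G.EdgeVerticialContainment ∧ G.EdgeVerticialAbutment := by
  classical
  -- (0) the public rows: `Π_{v₀} ∩ Π_{v₁} = Π_ν`, `Π_{v₀} ≠ Π_{v₁}`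
  obtain ⟨-, -, hinf, hvne⟩ := G.twoComponentAffine_freeFactor_rows hne hprime ι hι hs hsr e hC v₀ v₁ hV ε
    hε hV₀ hV₁ n₀ hN hE
  have hv01 : v₀ ≠ v₁ := fun h => hvne (by rw [h])
  obtain ⟨r', rfl⟩ : ∃ r', r = r' + 1 := ⟨r - 1, by omega⟩
  have hp : ∃ p ∈ Sigma, p.Prime := hne.imp fun p hp => ⟨hp, hprime p hp⟩
  have hhyp : PuncturedSurfaceGroup.IsHyperbolicType g (r' + 1) := by
    unfold PuncturedSurfaceGroup.IsHyperbolicType; omega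
  have hs1' : s - 1 < r' := by omega
  have hs' : s < r' := by omega
  have hr0 : 0 < r' := by omega
  have hsr₁ : s < r' + 1 := by omega
  have hr0₁ : 0 < r' + 1 := by omega
  -- (1) the node-loop basis and the two Nielsen variants (abc-iut-f-166 / f-164)
  obtain ⟨b', ha', hb', hc', hk'⟩ := exists_freeGroupBasis_nodeLoop g r' g₀ s (by omega) (by omega) ε hε
  have hk : ∀ h : s - 1 < r', b' (Sum.inr ⟨s - 1, h⟩) = ε := fun _ => hk'
  obtain ⟨b₄, hb₄τ, hb₄⟩ :=
    exists_freeGroupBasis_nodeLoop_cusp hε ha' hb' hc' hk (by omega) (by omega)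
  obtain ⟨b₅, hb₅κ, hb₅⟩ :=
    exists_freeGroupBasis_nodeLoop_cusp_zero hε ha' hb' hc' hk hs (by omega)
  set S₀ : Set ((Fin g × Bool) ⊕ Fin r') :=
    {x | Sum.elim (fun p : Fin g × Bool => (p.1 : ℕ) < g₀) (fun j : Fin r' => s ≤ (j : ℕ) + 1) x} with hS₀
  set T₁ : Set ((Fin g × Bool) ⊕ Fin r') :=
    {x | Sum.elim (fun p : Fin g × Bool => g₀ ≤ (p.1 : ℕ)) (fun j : Fin r' => (j : ℕ) + 1 ≤ s) x} with hT₁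
  have hSr : ∀ j : Fin r', (Sum.inr j : (Fin g × Bool) ⊕ Fin r') ∈ S₀ ↔ s ≤ (j : ℕ) + 1 := fun _ => Iff.rfl
  have hTr : ∀ j : Fin r', (Sum.inr j : (Fin g × Bool) ⊕ Fin r') ∈ T₁ ↔ (j : ℕ) + 1 ≤ s := fun _ => Iff.rfl
  set σ : (Fin g × Bool) ⊕ Fin r' := Sum.inr ⟨s - 1, hs1'⟩ with hσ
  set τ : (Fin g × Bool) ⊕ Fin r' := Sum.inr ⟨s, hs'⟩ with hτ
  set κ : (Fin g × Bool) ⊕ Fin r' := Sum.inr ⟨0, hr0⟩ with hκ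
  have hτT : τ ∉ T₁ := fun h => by have := (hTr _).mp h; simp only at this; omega
  have hκS : κ ∉ S₀ := fun h => by have := (hSr _).mp h; simp only at this; omega
  -- the representatives as sub-basis closures
  have hA₀ : G.vertGp v₀ = ((Subgroup.closure (b' '' S₀)).map ι).topologicalClosure := by
    rw [hV₀, closure_firstSubsurface_eq_nodeLoopBasis hε ha' hb' hc' hk (by omega) (by omega)]
  have hA₁ : G.vertGp v₁ = ((Subgroup.closure (b' '' T₁)).map ι).topologicalClosure := by
    rw [hV₁, closure_secondSubsurface_eq_nodeLoopBasis hε ha' hb' hc' hk (by omega) (by omega)]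
  have hN₀ : G.nodeGp n₀ = ((Subgroup.closure (b' '' {σ})).map ι).topologicalClosure := by
    rw [hE, closure_image_singleton, hσ, hk hs1']
  have hK : ∀ j : Fin (r' + 1), ((PuncturedSurfaceGroup.cuspInertia (g := g) j).map ι).topologicalClosure =
      ((Subgroup.zpowers (c (g := g) j)).map ι).topologicalClosure := fun _ => rfl
  have hKb' : ∀ (j : Fin (r' + 1)) (hj0 : (j : ℕ) ≠ 0), (j : ℕ) ≠ s →
      Subgroup.zpowers (c (g := g) j) =
        Subgroup.closure (b' '' {Sum.inr (j.pred (fun h => hj0 (by rw [h]; rfl)))}) := by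
    intro j hj0 hjs
    rw [closure_image_singleton, hc' _ (by rw [Fin.val_pred]; omega), Fin.succ_pred]
  have hKτ : Subgroup.zpowers (c (g := g) ⟨s, hsr₁⟩) = Subgroup.closure (b₄ '' {τ}) := by
    rw [closure_image_singleton, hτ, hb₄τ]
  have hKκ : Subgroup.zpowers (c (g := g) ⟨0, hr0₁⟩) = Subgroup.closure (b₅ '' {κ}) := by
    rw [closure_image_singleton, hκ, hb₅κ]
  have hT₁b₄ : Subgroup.closure (b' '' T₁) = Subgroup.closure (b₄ '' T₁) :=
    closure_image_congr fun x hx => (hb₄ x (fun h => hτT (h ▸ hx))).symm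
  have hS₀b₅ : Subgroup.closure (b' '' S₀) = Subgroup.closure (b₅ '' S₀) :=
    closure_image_congr fun x hx => (hb₅ x (fun h => hκS (h ▸ hx))).symm
  -- (2) cusps of `C₀` vs `Π_{v₁}`, cusps of `C₁` vs `Π_{v₀}` (abc-iut-f-164's computation)
  have hCV₁ : ∀ (j : Fin (r' + 1)), s ≤ (j : ℕ) → ∀ x : P,
      ((PuncturedSurfaceGroup.cuspInertia (g := g) j).map ι).topologicalClosure ⊓
        ConjAct.toConjAct x • G.vertGp v₁ = ⊥ := by
    intro j hj x
    rw [hK, hA₁]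
    by_cases hjs : (j : ℕ) = s
    · have hj' : j = ⟨s, hsr₁⟩ := Fin.ext hjs
      rw [hj', hKτ, hT₁b₄]
      exact freeFactor_inf_conj_eq_bot_of_disjoint b₄ {τ} T₁ (Set.disjoint_singleton_left.mpr hτT) hι x
    · rw [hKb' j (by omega) hjs]
      refine freeFactor_inf_conj_eq_bot_of_disjoint b' _ T₁ (Set.disjoint_singleton_left.mpr ?_) hι x
      rw [hTr, Fin.val_pred]
      omega
  have hCV₀ : ∀ (j : Fin (r' + 1)), (j : ℕ) < s → ∀ x : P,
      ((PuncturedSurfaceGroup.cuspInertia (g := g) j).map ι).topologicalClosure ⊓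
        ConjAct.toConjAct x • G.vertGp v₀ = ⊥ := by
    intro j hj x
    rw [hK, hA₀]
    by_cases hj0 : (j : ℕ) = 0
    · have hj' : j = ⟨0, hr0₁⟩ := Fin.ext hj0
      rw [hj', hKκ, hS₀b₅]
      exact freeFactor_inf_conj_eq_bot_of_disjoint b₅ {κ} S₀ (Set.disjoint_singleton_left.mpr hκS) hι x
    · rw [hKb' j hj0 (by omega)]
      refine freeFactor_inf_conj_eq_bot_of_disjoint b' _ S₀ (Set.disjoint_singleton_left.mpr ?_) hι x
      rw [hSr, Fin.val_pred]
      omega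
  -- (3) where the cusps abut: `cuspEnd c' = v₀` for `e c' ≥ s`, `= v₁` for `e c' < s`
  have hcinf : ∀ c', Infinite (G.cuspGp c') := fun c' => by
    rw [hC c']
    exact infinite_cuspInertia_closure hne hprime hhyp ι hι (e c')
  have hcusp₀ : ∀ c', s ≤ ((e c' : Fin (r' + 1)) : ℕ) → G.graph.cuspEnd c' = v₀ := by
    intro c' hj
    rcases hV (G.graph.cuspEnd c') with h | h
    · exact h
    · exfalso
      have hb := hCV₁ (e c') hj 1
      rw [map_one, one_smul, ← hC c', ← h, inf_eq_left.mpr (hcuspEnd c')] at hb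
      exact ne_bot_of_infinite₅ (hcinf c') hb
  have hcusp₁ : ∀ c', ((e c' : Fin (r' + 1)) : ℕ) < s → G.graph.cuspEnd c' = v₁ := by
    intro c' hj
    rcases hV (G.graph.cuspEnd c') with h | h
    · exfalso
      have hb := hCV₀ (e c') hj 1
      rw [map_one, one_smul, ← hC c', ← h, inf_eq_left.mpr (hcuspEnd c')] at hb
      exact ne_bot_of_infinite₅ (hcinf c') hb
    · exact h
  -- (4) the criteria
  have hmal : ∀ (v : G.graph.V) (x : P), G.vertGp v ⊓ ConjAct.toConjAct x • G.vertGp v ≠ ⊥ →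
      x ∈ G.vertGp v := by
    intro v x h
    rcases hV v with rfl | rfl
    · rw [hA₀] at h ⊢; exact mem_freeFactor_of_inf_conj_ne_bot b' _ hι h
    · rw [hA₁] at h ⊢; exact mem_freeFactor_of_inf_conj_ne_bot b' _ hι h
  have hnt : ∀ e' : G.graph.N ⊕ G.graph.C, G.edgeGp e' ≠ ⊥ := by
    rintro (n | c')
    · change G.nodeGp n ≠ ⊥
      rw [hN n, hN₀]
      exact ne_bot_of_infinite₅ (infinite_freeFactor b' _ ⟨σ, rfl⟩ hι hp)
    · exact ne_bot_of_infinite₅ (hcinf c')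
  -- everywhere-disjointness when a cusp does not abut to `v`
  have hcdis : ∀ (c' : G.graph.C) (v : G.graph.V), G.graph.cuspEnd c' ≠ v →
      ∀ x : P, G.vertGp v ⊓ ConjAct.toConjAct x • G.edgeGp (Sum.inr c') = ⊥ := by
    intro c' v hv x
    change G.vertGp v ⊓ ConjAct.toConjAct x • G.cuspGp c' = ⊥
    rw [hC c']
    by_cases hj : s ≤ ((e c' : Fin (r' + 1)) : ℕ)
    · have hv₁ : v = v₁ := by
        rcases hV v with rfl | rfl
        · exact absurd (hcusp₀ c' hj) hv
        · rfl
      subst hv₁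
      exact inf_conj_eq_bot_symm (hCV₁ (e c') hj) x
    · have hv₀ : v = v₀ := by
        rcases hV v with rfl | rfl
        · rfl
        · exact absurd (hcusp₁ c' (by omega)) hv
      subst hv₀
      exact inf_conj_eq_bot_symm (hCV₀ (e c') (by omega)) x
  refine ⟨G.edgeVerticialContainment_of_malnormal hmal ?_, G.edgeVerticialAbutment_of_disjoint hnt ?_⟩
  · rintro (n | c') v
    · refine Or.inl ⟨1, ?_⟩
      rw [map_one, one_smul]
      change G.nodeGp n ≤ G.vertGp v
      rw [hN n, ← hinf]
      rcases hV v with rfl | rfl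
      · exact inf_le_left
      · exact inf_le_right
    · by_cases hv : G.graph.cuspEnd c' = v
      · refine Or.inl ⟨1, ?_⟩
        rw [map_one, one_smul, ← hv]
        exact hcuspEnd c'
      · exact Or.inr (hcdis c' v hv)
  · rintro (n | c') v hab x
    · exfalso
      apply hab
      rw [abuts_inl_iff, hN n, hends]
      rcases hV v with rfl | rfl
      · exact Sym2.mem_mk_left _ _
      · exact Sym2.mem_mk_right _ _
    · exact hcdis c' v (fun h => hab (by rw [abuts_inr_iff, h])) x

end PSCDatum

end Literature.AnabelianGeometry.SemiGraphs

end
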